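import Summits.ABC.IUTFork.Cor312RamifiedIsmBarrier
import Summits.ABC.IUTFork.Repair.CandMochizuki7RamInd
import HarnessLib

/-!
# IUT REPAIR BRANCH (rung LADDER-ABC:A2.RP) — ISOMETRIC readings of Ism on the ramified bed: (Ind1),(Ind2) ELIMINABLE, typed Corollary
# FALSE at EVERY depth; the (†ΘCR)/(SSInd) disagreement changes the typed verdict exactly at depth 1

Record file (D-0012; MODEL DATA `PiVec`/`isoK` — the valuation-ISOMETRIES of `K = ℚ_p(π)` as a reading of Ism —, then proofs; no `Prop` fact; nothing
asserted about print) of the abc-iut cell, seat abc-iut-rp-m1 (gen 3; class (ii)). TAKES NO SIDE on [IUTchIII] Cor. 3.12 or on any author; candidates are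
hypotheses; typed ≠ proved. Sequel to `Cor312RamifiedIsmBarrier` (RAM_{G₁,G₂}(p, m) for an ARBITRARY reading `1 ∈ Gᵢ ⊆ GL(I)`; `not_statementWith`: no reading
rescues the typed Corollary at depth `m ≥ 2`) and `Repair/CandMochizuki7RamInd` (`coord_factorwise_tb`, the Kronecker formula).

THE ISOMETRIC READINGS. Print DEFINES (Ind2) through Ism = `G`-ISOMETRIES ([IUTchIII] Thm. 3.11 (i), p. 154; [IUTchII] Ex. 1.8 (iv), p. 39 l. 5–10). On
`ℚ² = ℚ·1 ⊕ ℚ·π` the most generous isometric reading is **`isoK` := the `ℚ`-linear automorphisms preserving BOTH lattices `𝒪_K = I` and `π·𝒪_K`** (hence every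
`π^k·𝒪_K`: the stabiliser of the lattice chain, ⊋ the `𝒪_K^×`-multiplications and Galois; ⊉ the swap `1 ↔ π`, `swap2_not_mem_isoK`). KERNEL:
* `valMono_*` / `image_box_eq_of_mem_closureIso` — for EVERY reading `1 ∈ G₁, G₂ ⊆ isoK`, every element of the (Ind1),(Ind2)-group maps every polydisc
  `box k` ONTO ITSELF (factorwise valuation-isometries do not lower the `π`-adic valuation of any tensor monomial: the entry `(1, π) ↦ 1` is `p`-divisible);
* `thetaHullWith_eq_thetaBox_of_isometric` — hence `ⁿ˒°𝒰_j = box(m·j²)` = the Θ-box: **(Ind1),(Ind2) are ELIMINABLE** under every isometric reading (the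
  (SSInd) sentence, [Rpt2018] p. 9 l. 17–21, is TRUE of these readings on RAM), `−|log(Θ)| = −(5m/4)·log p` (`negLogThetaWith_isometric`);
* **`not_statementWith_of_isometric` (`m ≥ 1`): under EVERY isometric reading the typed Corollary FAILS at EVERY ramified depth, including `m = 1`**;
* `ram_depth_one_dichotomy` — at the shallowest datum `m = 1`: isometric readings ⟹ `¬ Statement`; the full lattice reading ⟹ `Statement` attained
  (`RamifiedWitness.ramSetting_statement_attained_one`). With `not_statementWith` (depth ≥ 2, every reading) this is the complete typed form, on the toy, of
  the exchange (†ΘCR) «(Ind1,2) cannot be eliminated» ([Rpt2018] p. 16 l. 58–66) vs (SSInd) «unaffected if eliminated» (p. 9 l. 17–21): the two readings of Ism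
  give different typed verdicts EXACTLY at depth 1, and neither gives the Corollary at depth ≥ 2.
HONEST SCOPE: one place, `l⋇ = 2`, `K = ℚ_p(√p)` toy, equal-radii polydisc frame; no side taken. [claim: Mochizuki2019Report, status: disputed]
[claim: Mochizuki2012, status: disputed] [cite: ScholzeStix2018, §2.2 pp. 9–10]
-/

noncomputable section

open Set

namespace Summit.ABC.IUTFork.Repair.CandMochizuki7Ram

open Thm311 Cor312 Cor312.Checks Cor312.IdentifiedNonVacuity Cor312Vol Cor312Vol.NaiveWitness Cor312Vol.PinnedWitness
  Cor312Vol.RamifiedWitness Literature.IUT.LogThetaLattice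

variable (p : ℕ)

/-! ## 1. The valuation-isometries `isoK` of `K = ℚ_p(π)` -/

/-- `x = x_1·1 + x_π·π ∈ π·𝒪_K`: `v_p(x_1) ≥ 1` and `x_π ∈ ℤ_(p)`. [claim: Mochizuki2012, status: disputed] -/
def PiVec (x : Fin 2 → ℚ) : Prop := PLe p 1 (x 0) ∧ IsPInt p (x 1)

/-- **`isoK`: the VALUATION-ISOMETRIES of `K`** — the `ℚ`-linear automorphisms `g` of `ℚ²` with `x ∈ 𝒪_K ⟺ g x ∈ 𝒪_K` and `x ∈ π𝒪_K ⟺ g x ∈ π𝒪_K`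
(hence `g(π^k𝒪_K) = π^k𝒪_K` for all `k`): the most generous ISOMETRIC reading of print's Ism on the ramified shell (⊇ `𝒪_K^×`-multiplications, Galois).
[claim: Mochizuki2012, status: disputed] -/
def isoK : Set ((Fin 2 → ℚ) ≃ₗ[ℚ] (Fin 2 → ℚ)) := {g | ∀ x, (IntVec p x ↔ IntVec p (g x)) ∧ (PiVec p x ↔ PiVec p (g x))}

/-- The identity is a valuation-isometry. [folklore] -/
theorem refl_mem_isoK : LinearEquiv.refl ℚ (Fin 2 → ℚ) ∈ isoK p := fun _ => ⟨Iff.rfl, Iff.rfl⟩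

/-- Valuation-isometries are lattice automorphisms. [folklore] -/
theorem isoK_subset_latticeAuts : isoK p ⊆ latticeAuts p := fun _ hg x => (hg x).1

variable {p}

/-- Valuation-isometries are closed under inversion. [folklore] -/
theorem symm_mem_isoK {g : (Fin 2 → ℚ) ≃ₗ[ℚ] (Fin 2 → ℚ)} (hg : g ∈ isoK p) : g.symm ∈ isoK p := fun x => by
  constructor
  · rw [(hg (g.symm x)).1, LinearEquiv.apply_symm_apply]
  · rw [(hg (g.symm x)).2, LinearEquiv.apply_symm_apply]

/-- **The entry `(1, π)` of a valuation-isometry is `p`-divisible**: `g(π) ∈ π𝒪_K`, so its `1`-coordinate has `v_p ≥ 1`. [folklore] -/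
theorem ple_one_ent_isoK [Fact p.Prime] {g : (Fin 2 → ℚ) ≃ₗ[ℚ] (Fin 2 → ℚ)} (hg : g ∈ isoK p) : PLe p 1 (ent g 0 1) := by
  have h : PiVec p (Pi.single (1 : Fin 2) (1 : ℚ)) := ⟨by rw [Pi.single_eq_of_ne (by decide)]; exact ple_zero 1, by
    rw [Pi.single_eq_same]; exact isPInt_one⟩
  exact (((hg _).2).1 h).1

/-- The swap `1 ↔ π` is NOT a valuation-isometry (`π ↦ 1 ∉ π𝒪_K`): Dupuy–Hilado's `GL(I)` strictly exceeds every isometric reading. [folklore] -/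
theorem swap2_not_mem_isoK [Fact p.Prime] : swap2 ∉ isoK p := fun h => by
  have h1 := ple_one_ent_isoK h
  unfold ent at h1
  rw [swap2_single, Equiv.swap_apply_right, Pi.single_eq_same] at h1
  rcases h1 with h1 | h1
  · exact one_ne_zero h1
  · rw [padicValRat.one] at h1; exact absurd h1 (by norm_num)

/-! ## 2. Valuation-monotone linear maps preserve every polydisc -/

/-- A linear self-map of a packet is VALUATION-MONOTONE: the `ε`-coordinate of `f(e_{ε'})` has `π`-adic valuation `≥ wt ε' − wt ε` — `f` does not lower
the valuation of any tensor monomial. [folklore] -/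
def ValMono (j : toyIndex.Label) (vQ : toyIndex.VQ) (f : (ramShells p).Packet j vQ →ₗ[ℚ] (ramShells p).Packet j vQ) : Prop :=
  ∀ ε' ε, PLe p (((wt ε' : ℤ) - wt ε + 1) / 2) (coord p j vQ (f (tb p j vQ ε')) ε)

/-- **A valuation-monotone map sends `box k` into `box k`.** [folklore] -/
theorem box_map_of_valMono [Fact p.Prime] {j : toyIndex.Label} {vQ : toyIndex.VQ}
    {f : (ramShells p).Packet j vQ →ₗ[ℚ] (ramShells p).Packet j vQ} (hf : ValMono j vQ f) {k : ℤ} {x : (ramShells p).Packet j vQ}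
    (hx : x ∈ box p j vQ k) : f x ∈ box p j vQ k := fun ε => by
  rw [coord_map_eq_sum]
  refine ple_sum _ _ fun ε' _ => ?_
  exact ((hx ε').mul (hf ε' ε)).mono (by omega)

/-- The weight is invariant under re-indexing the tensor factors. [folklore] -/
theorem wt_comp_equiv {j : toyIndex.Label} (ε : toyIndex.Caps j → Fin 2) (σ : Equiv.Perm (toyIndex.Caps j)) :
    wt (fun i => ε (σ i)) = wt ε := by
  unfold wt
  exact Equiv.sum_comp σ (fun i => ((ε i : Fin 2) : ℕ))

/-- **A permutation of the tensor factors is valuation-monotone** (it permutes the monomials, preserving weights). [folklore] -/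
theorem valMono_permute [Fact p.Prime] (j : toyIndex.Label) (vQ : toyIndex.VQ) (σ : Equiv.Perm (toyIndex.Caps j)) :
    ValMono j vQ ((ramShells p).permute j vQ σ).toLinearMap := fun ε' ε => by
  rw [LinearEquiv.coe_coe, tb_apply]
  unfold LogShells.permute
  erw [PiTensorProduct.reindex_tprod]
  rw [← tb_apply, coord_tb]
  split_ifs with h
  · rw [← h, wt_comp_equiv]
    exact isPInt_one.mono (by omega)
  · exact ple_zero _

/-- A product with per-factor valuation bounds has valuation at least the sum of the bounds. [folklore] -/
theorem ple_prod [Fact p.Prime] {ι : Type} [DecidableEq ι] (s : Finset ι) (d : ι → ℤ) (f : ι → ℚ)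
    (h : ∀ i ∈ s, PLe p (d i) (f i)) : PLe p (∑ i ∈ s, d i) (∏ i ∈ s, f i) := by
  induction s using Finset.induction_on with
  | empty => simpa using isPInt_one (p := p)
  | insert a s ha ih =>
    rw [Finset.sum_insert ha, Finset.prod_insert ha]
    exact (h a (Finset.mem_insert_self a s)).mul (ih fun i hi => h i (Finset.mem_insert_of_mem hi))

/-- Per-factor bound for a valuation-isometry: the entry `(a, b)` has `v_p ≥ [a = 1-coordinate ∧ b = π-coordinate]`, and
`b ≤ a + [a = 0 ∧ b = 1]` as weights. [folklore] -/
theorem ple_ent_isoK [Fact p.Prime] {g : (Fin 2 → ℚ) ≃ₗ[ℚ] (Fin 2 → ℚ)} (hg : g ∈ isoK p) (a b : Fin 2) :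
    PLe p (if a = 0 ∧ b = 1 then 1 else 0) (ent g a b) ∧ ((b : ℕ) : ℤ) ≤ (a : ℕ) + (if a = 0 ∧ b = 1 then (1 : ℤ) else 0) := by
  by_cases h : a = 0 ∧ b = 1
  · obtain ⟨rfl, rfl⟩ := h
    exact ⟨by rw [if_pos ⟨rfl, rfl⟩]; exact ple_one_ent_isoK hg, by simp⟩
  · rw [if_neg h, add_zero]
    refine ⟨isPInt_ent (isoK_subset_latticeAuts p hg) a b, ?_⟩
    have ha := a.isLt; have hb := b.isLt
    push Not at h
    by_cases ha0 : a = 0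
    · have hb1 : b ≠ 1 := h ha0
      have : (b : ℕ) = 0 := by have := Fin.val_ne_of_ne hb1; simp at this; omega
      simp [this]
    · have : (a : ℕ) = 1 := by have := Fin.val_ne_of_ne ha0; simp at this; omega
      rw [this]; push_cast; omega

/-- **A factorwise valuation-isometry is valuation-monotone** (Kronecker formula + the per-factor bounds). [folklore] -/
theorem valMono_factorwise [Fact p.Prime] {j : toyIndex.Label} {vQ : toyIndex.VQ}
    (g : toyIndex.Caps j → ∀ v : toyIndex.Fibre vQ, (Fin 2 → ℚ) ≃ₗ[ℚ] (Fin 2 → ℚ)) (hg : ∀ i v, g i v ∈ isoK p) :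
    ValMono j vQ ((ramShells p).factorwise j vQ fun i => (ramShells p).summandwise vQ (g i)).toLinearMap := fun ε' ε => by
  classical
  rw [LinearEquiv.coe_coe, coord_factorwise_tb]
  have hprod := ple_prod (p := p) Finset.univ (fun i => if ε i = 0 ∧ ε' i = 1 then (1 : ℤ) else 0)
    (fun i => ent (g i (fib vQ)) (ε i) (ε' i)) fun i _ => (ple_ent_isoK (hg i (fib vQ)) (ε i) (ε' i)).1
  refine hprod.mono ?_
  have hsum : ((wt ε' : ℕ) : ℤ) ≤ (wt ε : ℕ) + ∑ i, (if ε i = 0 ∧ ε' i = 1 then (1 : ℤ) else 0) := by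
    unfold wt
    push_cast
    rw [← Finset.sum_add_distrib]
    exact Finset.sum_le_sum fun i _ => (ple_ent_isoK (hg i (fib vQ)) (ε i) (ε' i)).2
  have hnn : (0 : ℤ) ≤ ∑ i, (if ε i = 0 ∧ ε' i = 1 then (1 : ℤ) else 0) :=
    Finset.sum_nonneg fun i _ => by split_ifs <;> norm_num
  omega

/-! ## 3. Every element of the (Ind1),(Ind2)-group of an isometric reading fixes every polydisc -/

section Iso

variable {G₁ G₂ : Set ((Fin 2 → ℚ) ≃ₗ[ℚ] (Fin 2 → ℚ))} {h₁ : LinearEquiv.refl ℚ (Fin 2 → ℚ) ∈ G₁} {h₂ : LinearEquiv.refl ℚ (Fin 2 → ℚ) ∈ G₂}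
  [hp : Fact p.Prime]

/-- A packet-automorphism family PRESERVES THE POLYDISCS if it and its inverse map every `box k` into itself. [folklore] -/
structure PreservesBoxes (Φ : (ramShells p).PacketAut) : Prop where
  /-- `Φ` maps boxes into boxes -/
  fwd : ∀ (j : toyIndex.Label) (vQ : toyIndex.VQ) (k : ℤ) (x : (ramShells p).Packet j vQ), x ∈ box p j vQ k → Φ j vQ x ∈ box p j vQ k
  /-- `Φ⁻¹` maps boxes into boxes -/
  bwd : ∀ (j : toyIndex.Label) (vQ : toyIndex.VQ) (k : ℤ) (x : (ramShells p).Packet j vQ), x ∈ box p j vQ k → Φ⁻¹ j vQ x ∈ box p j vQ k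

omit hp in
/-- The identity preserves the polydiscs. [folklore] -/
theorem preservesBoxes_one : PreservesBoxes (p := p) 1 :=
  ⟨fun _ _ _ _ hx => hx, fun _ _ _ _ hx => by rw [inv_one]; exact hx⟩

omit hp in
/-- Closed under products. [folklore] -/
theorem PreservesBoxes.mul {Φ Ψ : (ramShells p).PacketAut} (hΦ : PreservesBoxes Φ) (hΨ : PreservesBoxes Ψ) : PreservesBoxes (Φ * Ψ) :=
  ⟨fun j vQ k x hx => hΦ.fwd j vQ k _ (hΨ.fwd j vQ k x hx), fun j vQ k x hx => by
    rw [mul_inv_rev]; exact hΨ.bwd j vQ k _ (hΦ.bwd j vQ k x hx)⟩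

omit hp in
/-- Closed under inverses. [folklore] -/
theorem PreservesBoxes.inv' {Φ : (ramShells p).PacketAut} (hΦ : PreservesBoxes Φ) : PreservesBoxes Φ⁻¹ :=
  ⟨hΦ.bwd, fun j vQ k x hx => by rw [inv_inv]; exact hΦ.fwd j vQ k x hx⟩

/-- (Ind2)-families of an isometric reading preserve the polydiscs. [folklore] -/
theorem preservesBoxes_of_mem_Ind2FamilyWith (hG₂ : G₂ ⊆ isoK p) {Φ : (ramShells p).PacketAut}
    (h : Φ ∈ (ramShellsWith p G₁ G₂ h₁ h₂).Ind2Family) : PreservesBoxes Φ := by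
  refine ⟨fun j vQ k x hx => ?_, fun j vQ k x hx => ?_⟩
  · obtain ⟨g, hg, hΦ⟩ := h j vQ
    rw [hΦ]
    exact box_map_of_valMono (valMono_factorwise g fun i v => hG₂ (hg i v)) hx
  · obtain ⟨g, hg, hΦ⟩ := h j vQ
    have hΦ' : Φ j vQ = (ramShells p).factorwise j vQ fun i => (ramShells p).summandwise vQ (g i) := hΦ
    rw [Pi.inv_apply, Pi.inv_apply, hΦ', factorwise_summandwise_inv]
    exact box_map_of_valMono (valMono_factorwise _ fun i v => symm_mem_isoK (hG₂ (hg i v))) hx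

/-- (Ind1)-families of an isometric reading preserve the polydiscs. [folklore] -/
theorem preservesBoxes_of_mem_Ind1FamilyWith (hG₁ : G₁ ⊆ isoK p) {Φ : (ramShells p).PacketAut}
    (h : Φ ∈ (ramShellsWith p G₁ G₂ h₁ h₂).Ind1Family) : PreservesBoxes Φ := by
  refine ⟨fun j vQ k x hx => ?_, fun j vQ k x hx => ?_⟩
  · obtain ⟨σ, hh, hmem, hΦ⟩ := h j
    have hΦ' : Φ j vQ = ((ramShells p).permute j vQ σ).trans
        ((ramShells p).factorwise j vQ fun i => (ramShells p).summandwise vQ fun v => hh i v.1) := hΦ vQ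
    rw [hΦ', LinearEquiv.trans_apply]
    exact box_map_of_valMono (valMono_factorwise (fun i v => hh i v.1) fun i v => hG₁ (hmem i v.1))
      (box_map_of_valMono (valMono_permute j vQ σ) hx)
  · obtain ⟨σ, hh, hmem, hΦ⟩ := h j
    have hΦ' : Φ j vQ = ((ramShells p).factorwise j vQ fun i => (ramShells p).summandwise vQ fun v => hh i v.1) *
        (ramShells p).permute j vQ σ := by
      rw [LinearEquiv.mul_eq_trans]; exact hΦ vQ
    rw [Pi.inv_apply, Pi.inv_apply, hΦ', mul_inv_rev, factorwise_summandwise_inv, ← LogShells.permute_inv, LinearEquiv.mul_apply]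
    exact box_map_of_valMono (valMono_permute j vQ σ⁻¹)
      (box_map_of_valMono (valMono_factorwise _ fun i v => symm_mem_isoK (hG₁ (hmem i v.1))) hx)

/-- **Every element of the (Ind1),(Ind2)-group of an isometric reading maps every polydisc ONTO itself.** [folklore] -/
theorem image_box_eq_of_mem_closureIso (hG₁ : G₁ ⊆ isoK p) (hG₂ : G₂ ⊆ isoK p) {Φ : (ramShells p).PacketAut}
    (hΦ : Φ ∈ Subgroup.closure ((ramShellsWith p G₁ G₂ h₁ h₂).Ind1Family ∪ (ramShellsWith p G₁ G₂ h₁ h₂).Ind2Family))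
    (j : toyIndex.Label) (vQ : toyIndex.VQ) (k : ℤ) : Φ j vQ '' box p j vQ k = box p j vQ k := by
  have hP : PreservesBoxes Φ := by
    induction hΦ using Subgroup.closure_induction with
    | mem Ψ hΨ =>
      rcases hΨ with h1 | h2
      · exact preservesBoxes_of_mem_Ind1FamilyWith hG₁ h1
      · exact preservesBoxes_of_mem_Ind2FamilyWith hG₂ h2
    | one => exact preservesBoxes_one
    | mul Ψ Ψ' _ _ hΨ hΨ' => exact hΨ.mul hΨ'
    | inv Ψ _ hΨ => exact hΨ.inv'
  apply Set.Subset.antisymm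
  · rintro _ ⟨x, hx, rfl⟩; exact hP.fwd j vQ k x hx
  · intro y hy
    refine ⟨(Φ j vQ).symm y, ?_, (Φ j vQ).apply_symm_apply y⟩
    exact hP.bwd j vQ k y hy

/-! ## 4. Isometric readings: (Ind1),(Ind2) ELIMINABLE, typed Corollary FALSE at every depth -/

variable (p) (h₁ h₂) (m : ℕ)

/-- **Under an isometric reading the possible images are the Θ-box alone, so `ⁿ˒°𝒰_j = box(m·j²)`: (Ind1),(Ind2) are ELIMINABLE.**
[claim: Mochizuki2012, status: disputed] -/
theorem thetaHullWith_eq_thetaBox_of_isometric (hG₁ : G₁ ⊆ isoK p) (hG₂ : G₂ ⊆ isoK p) (j : toyIndex.Label) (vQ : toyIndex.VQ) :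
    (ramSettingWith p G₁ G₂ h₁ h₂ m).thetaHull j vQ = box p j vQ ((m : ℤ) * jsq j) := by
  have hU : (⋃₀ (ramSettingWith p G₁ G₂ h₁ h₂ m).possibleImages j vQ : Set ((ramSituationWith p G₁ G₂ h₁ h₂).L.Packet j vQ)) =
      box p j vQ ((m : ℤ) * jsq j) := by
    apply Set.Subset.antisymm
    · rintro x ⟨U, ⟨Φ, hΦ, rfl⟩, hx⟩
      rw [ramSettingWith_thetaRegion3] at hx
      have himg : Φ j vQ '' box p j vQ ((m : ℤ) * jsq j) = box p j vQ ((m : ℤ) * jsq j) :=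
        image_box_eq_of_mem_closureIso hG₁ hG₂ hΦ j vQ _
      rw [himg] at hx
      exact hx
    · exact thetaBox_subset_sUnion_possibleImagesWith p h₁ h₂ m j vQ
  exact (congrArg (rFrame p j vQ).hull hU).trans (rFrame_hull_box j vQ _)

/-- The local Θ-term under an isometric reading: `μ(box(m·j²)) = −(m·j²/2)·log p` (no inflation). [folklore] -/
theorem thetaLocalWith_isometric (hG₁ : G₁ ⊆ isoK p) (hG₂ : G₂ ⊆ isoK p) (j : toyIndex.Label) (vQ : toyIndex.VQ) :
    (ramSettingWith p G₁ G₂ h₁ h₂ m).thetaLocal j vQ = ((-((((m : ℤ) * jsq j : ℤ) : ℝ) / 2) * Real.log p : ℝ) : WithTop ℝ) := by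
  unfold Setting.thetaLocal
  rw [if_pos (ramSettingWith_hullDefined p h₁ h₂ m ((isoK_subset_latticeAuts p).trans' hG₁ |> fun h => hG₁.trans (isoK_subset_latticeAuts p))
    (hG₂.trans (isoK_subset_latticeAuts p)) j vQ)]
  show ((rVol p j vQ ((rFrame p j vQ).hull ((ramSettingWith p G₁ G₂ h₁ h₂ m).thetaHull j vQ)) : ℝ) : WithTop ℝ) = _
  rw [thetaHullWith_eq_thetaBox_of_isometric p h₁ h₂ m hG₁ hG₂, rFrame_hull_box, rVol_box]

/-- **`−|log(Θ)| = −(5m/4)·log p` under every isometric reading** (= the Θ-pilot's own volume: no gain). [claim: Mochizuki2012, status: disputed] -/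
theorem negLogThetaWith_isometric (hG₁ : G₁ ⊆ isoK p) (hG₂ : G₂ ⊆ isoK p) :
    (ramSettingWith p G₁ G₂ h₁ h₂ m).negLogTheta = ((-((5 : ℝ) * m / 4) * Real.log p : ℝ) : WithTop ℝ) := by
  unfold Setting.negLogTheta
  rw [if_pos (ramSettingWith_thetaFinite p h₁ h₂ m (hG₁.trans (isoK_subset_latticeAuts p)) (hG₂.trans (isoK_subset_latticeAuts p)))]
  have h : (fun i : Fin toyIndex.lstar =>
      ∑ᶠ vQ : toyIndex.VQ, ((ramSettingWith p G₁ G₂ h₁ h₂ m).thetaLocal (Setting.labelSucc i) vQ).untopD 0) =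
      fun i => -((((m : ℤ) * jsq (Setting.labelSucc i) : ℤ) : ℝ) / 2) * Real.log p := by
    funext i
    rw [finsum_unique, thetaLocalWith_isometric p h₁ h₂ m hG₁ hG₂, WithTop.untopD_coe]
  rw [h]
  congr 1
  unfold processionNormalized
  show (∑ i : Fin 2, -((((m : ℤ) * jsq (Setting.labelSucc i) : ℤ) : ℝ) / 2) * Real.log p) / ((2 : ℕ) : ℝ) = _
  have h0 : jsq (Setting.labelSucc ((0 : Fin 2) : Fin toyIndex.lstar) : toyIndex.Label) = 1 := rfl
  have h1 : jsq (Setting.labelSucc ((1 : Fin 2) : Fin toyIndex.lstar) : toyIndex.Label) = 4 := rfl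
  rw [Fin.sum_univ_two, h0, h1]
  push_cast
  ring

/-- **UNDER EVERY ISOMETRIC READING THE TYPED COROLLARY FAILS AT EVERY RAMIFIED DEPTH `m ≥ 1`** (`−(5m/4)·log p < −(m/2)·log p`).
[claim: Mochizuki2012, status: disputed] -/
theorem not_statementWith_of_isometric (hG₁ : G₁ ⊆ isoK p) (hG₂ : G₂ ⊆ isoK p) (hm : 1 ≤ m) :
    ¬ (ramSettingWith p G₁ G₂ h₁ h₂ m).Statement := by
  rintro ⟨-, h⟩
  rw [ramSettingWith_negLogQ, negLogThetaWith_isometric p h₁ h₂ m hG₁ hG₂, WithTop.coe_le_coe] at h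
  have hL := log_p_pos p
  have : (1 : ℝ) ≤ m := by exact_mod_cast hm
  nlinarith

/-- **The maximal isometric reading itself** (`Gᵢ = isoK`): countermodel at every depth `m ≥ 1`. [claim: Mochizuki2012, status: disputed] -/
theorem not_statement_isoK (hm : 1 ≤ m) :
    ¬ (ramSettingWith p (isoK p) (isoK p) (refl_mem_isoK p) (refl_mem_isoK p) m).Statement :=
  not_statementWith_of_isometric p (refl_mem_isoK p) (refl_mem_isoK p) m subset_rfl subset_rfl hm

/-- **THE DEPTH-ONE DICHOTOMY** (the typed (†ΘCR)/(SSInd) exchange on the toy): at the shallowest ramified datum `m = 1`, EVERY isometric reading of Ism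
refutes the typed Corollary, while Dupuy–Hilado's full lattice reading ATTAINS it; at every depth `m ≥ 2` no reading inside `GL(I)` rescues it
(`RamifiedWitness.not_statementWith`). [claim: Mochizuki2019Report, status: disputed] -/
theorem ram_depth_one_dichotomy (hG₁ : G₁ ⊆ isoK p) (hG₂ : G₂ ⊆ isoK p) :
    ¬ (ramSettingWith p G₁ G₂ h₁ h₂ 1).Statement ∧ (ramSetting p 1).Statement ∧
      (ramSetting p 1).negLogTheta = (((ramSetting p 1).negLogQ : ℝ) : WithTop ℝ) :=
  ⟨not_statementWith_of_isometric p h₁ h₂ 1 hG₁ hG₂ le_rfl, (ramSetting_statement_attained_one p).1, (ramSetting_statement_attained_one p).2⟩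

end Iso

end Summit.ABC.IUTFork.Repair.CandMochizuki7Ram

end
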